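import Summits.QuantumFields.YangMills.Theorems.BalabanUVNodesN06Row17LocalClauseAtFlat

/-!
# BalabanUVNodes ∕ N06 ([B9], `Dag.B9_main`) — ROW 17's LOCAL CENTRE NUMBER `m_□`, THE FIBRE READ ENTRYWISE: the three LOCAL LETTERS at node00-def-Y's
# `M_N(ℂ)`-valued letters (the hypotheses of `…N06Row17LocalCentreCoerciveReduction.coer_trIP_padDeltaALocY_one_of_classes`) FOLLOW FROM TWO REAL
# LETTERS about def-Y's flat kernels `gradK ∕ curlK ∕ qK ∕ qpK` — the local Lemma-2.4 letter on a real gauged class and the supported axial decomposition —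
# plus the real (2.11) letter (ROAD «C» W0 (b): the reduction to the V1-type REAL statements the N10 lane proves)

Track A of `YM-PLAN.md` (cell `pub-ymgap`, HUMAN RULING D-0062), node **N06** = [Balaban1985BackgroundPropagators] Thms 3.1–3.15; seat `pub-ymgap-dag-n06-j`
(bundle F5, rows 15–17), g24.  A HELPER (count-neutral, `--supports` only).

THE PRINT.  [B9] p. 395: *«It coincides with Δ_a in (2.19) of [4] if U = 1»* — at `U = 1` def-Y's letters are the LIFTS of the flat real kernels
(`gradY_one`, `curlY_one`, `QY_one`, `QpY_one`: `liftMatY`), acting on each real coordinate of each matrix entry; [4] = [Balaban1984PropagatorsII] (2.7) p. 224,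
(2.11) p. 225, (2.121) p. 244, Lemma 2.4 (2.128) p. 245.

WHAT.  For a cube site set `D`, a 0∕1 bond cut `χ`, a real class `𝒯ᵣ ⊆ (FBondY i → ℝ)` and constants `κ, π`:
(Rᴸ²⁴) `∀ v ∈ 𝒯ᵣ, κ·Σ_b v(b)² ≤ Σ_p ((curlK·v)(p))² + Σ_ι w(ι)·((qK·v)(ι))²` (the local Lemma-2.4 letter, real);
(Rᴾ) `∀ g, qpK·g = 0 → (∀ z ∉ D, g z = 0) → π·Σ_z g(z)² ≤ Σ_b ((gradK·g)(b))²` (the (2.11) letter, real — `B9Eq211PoincareAtLettersY` supplies it for ALL of `ker qpK`);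
(Rᴰ) `∀ v, ∃ g, qpK·g = 0 ∧ (∀ z ∉ D, g z = 0) ∧ (χ·v − gradK·g) ∈ 𝒯ᵣ` (the supported axial decomposition, real)
⟹ ★★★ `local_letters_of_real_letters`: there are classes `𝒯`, `𝒩` of `M_N(ℂ)`-valued bond ∕ site fields with EXACTLY the three hypotheses of
`coer_trIP_padDeltaALocY_one_of_classes` — `∀ B ∈ 𝒯, κ·⟨B,B⟩₁ ≤ ‖∂₁B‖²₁ + ‖Q(1)B‖²_w`; `∀ Λ ∈ 𝒩, Q′(1)Λ = 0 ∧ P_DΛ = Λ ∧ π·⟨Λ,Λ⟩₁ ≤ ⟨D₁Λ,D₁Λ⟩₁`;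
`∀ Ψ, ∃ B ∈ 𝒯, ∃ Λ ∈ 𝒩, M_χΨ = B + D₁Λ` — namely `𝒯 := {B | every real slice of B lies in 𝒯ᵣ}`, `𝒩 := {Λ | Q′(1)Λ = 0 ∧ P_DΛ = Λ ∧ the (2.11) bound}`; the
slices are (re ∕ im) of the `(a,b)` entries; the assembly of `Λ` from `2N²` real gauge functions is g22's device (`eq_zero_of_entries`, `re_liftMatY_apply`).
Ingredients: `trIP_self_eq_sum_entries` (the weighted trace norm entrywise), `re∕im_cutMulY_apply`, the slice lemmas for `gradY_one ∕ curlY_one ∕ QY_one ∕ QpY_one`.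
HONEST FRAMING.  Finite-dimensional bookkeeping at `U = 1`; the two∕three REAL letters are DISPLAYED; nothing of [B9]'s or [4]'s estimates asserted; COUNT-NEUTRAL;
N06 ∕ N10 NOT discharged; nothing continuum ∕ OS ∕ mass gap ∕ Clay.  0 `def`, 0 `sorry`.
-/

noncomputable section

namespace Summit.QuantumFields.YangMills.BalabanUVNodes.N06Row17LocalCentreLetters

open Literature.MathematicalPhysics.QuantumFieldTheory.Balaban1983to89
open Literature.MathematicalPhysics.QuantumFieldTheory.Balaban1983to89.Node00
open Literature.MathematicalPhysics.QuantumFieldTheory.Balaban1983to89.Node00.OpsYLocalInverse (cubeProjY cubeProjY_apply)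
open Literature.MathematicalPhysics.QuantumFieldTheory.Balaban1983to89.B9Thm311ReadingCoords (trIP)
open Literature.MathematicalPhysics.QuantumFieldTheory.Balaban1983to89.B9Thm37CubeCoverCommutators (cutMulY cutMulY_apply)
open Literature.MathematicalPhysics.QuantumFieldTheory.Balaban1983to89.B6KLevelCensusIndexV1 (KIdx)
open Summit.QuantumFields.YangMills.BalabanUVNodes.N06Row17LocalClauseAtFlat (re_liftMatY_apply im_liftMatY_apply eq_zero_of_entries eq_of_entries)
open scoped Matrix
open scoped Matrix.Norms.L2Operator

variable {N : ℕ} {d ℓ : ℕ} {hd : 1 ≤ d + 1} {hL : Odd (ℓ + 1) ∧ 1 < ℓ + 1} {b₀ b₁ : ℝ} (i : KIdx d ℓ hd hL b₀ b₁)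

/-! ## §1 The trace norm and the letters at `U = 1`, entrywise -/

section Entries

variable {S : Type} [Fintype S]

/-- the weighted trace norm as the weighted sum of the squares of the real coordinates of the entries. [cite: Balaban1985BackgroundPropagators, p.393 (scalar products), bookkeeping] -/
theorem trIP_self_eq_sum_entries (w : S → ℝ) (Ψ : S → Matrix (Fin N) (Fin N) ℂ) :
    trIP w Ψ Ψ = ∑ a : Fin N, ∑ b : Fin N, ((∑ s, w s * (Ψ s a b).re ^ 2) + ∑ s, w s * (Ψ s a b).im ^ 2) := by
  unfold trIP
  have h : ∀ s, w s * ∑ a, ∑ b, (star (Ψ s a b) * Ψ s a b).re = ∑ a, ∑ b, (w s * (Ψ s a b).re ^ 2 + w s * (Ψ s a b).im ^ 2) := by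
    intro s
    rw [Finset.mul_sum]
    refine Finset.sum_congr rfl fun a _ => ?_
    rw [Finset.mul_sum]
    refine Finset.sum_congr rfl fun b _ => ?_
    rw [Complex.star_def, Complex.mul_re, Complex.conj_re, Complex.conj_im]
    ring
  rw [Finset.sum_congr rfl fun s _ => h s, Finset.sum_comm]
  refine Finset.sum_congr rfl fun a _ => ?_
  rw [Finset.sum_comm]
  refine Finset.sum_congr rfl fun b _ => ?_
  rw [← Finset.sum_add_distrib]

omit [Fintype S] in
/-- the real part of an entry of a cut field. [cite: Balaban1985BackgroundPropagators, (3.79) p.406, bookkeeping] -/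
theorem re_cutMulY_apply (χ : S → ℝ) (Ψ : S → Matrix (Fin N) (Fin N) ℂ) (s : S) (a b : Fin N) :
    (cutMulY χ Ψ s a b).re = χ s * (Ψ s a b).re := by
  rw [cutMulY_apply, Matrix.smul_apply, smul_eq_mul, Complex.re_ofReal_mul]

omit [Fintype S] in
/-- the imaginary part of an entry of a cut field. [cite: Balaban1985BackgroundPropagators, (3.79) p.406, bookkeeping] -/
theorem im_cutMulY_apply (χ : S → ℝ) (Ψ : S → Matrix (Fin N) (Fin N) ℂ) (s : S) (a b : Fin N) :
    (cutMulY χ Ψ s a b).im = χ s * (Ψ s a b).im := by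
  rw [cutMulY_apply, Matrix.smul_apply, smul_eq_mul, Complex.im_ofReal_mul]

end Entries

/-- a weighted sum of squares of the real parts of the entries of a lifted kernel. [cite: Balaban1985BackgroundPropagators, p.395 («if U = 1»), bookkeeping] -/
theorem sum_sq_re_liftMatY {X Y : Type} [Fintype X] [Fintype Y] (w : Y → ℝ) (M : Matrix Y X ℝ) (Φ : X → Matrix (Fin N) (Fin N) ℂ) (a b : Fin N) :
    ∑ y, w y * (liftMatY (Matrix (Fin N) (Fin N) ℂ) M Φ y a b).re ^ 2 = ∑ y, w y * ((M *ᵥ fun x => (Φ x a b).re) y) ^ 2 :=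
  Finset.sum_congr rfl fun y _ => by rw [← re_liftMatY_apply]

/-- … and of the imaginary parts. [cite: Balaban1985BackgroundPropagators, p.395 («if U = 1»), bookkeeping] -/
theorem sum_sq_im_liftMatY {X Y : Type} [Fintype X] [Fintype Y] (w : Y → ℝ) (M : Matrix Y X ℝ) (Φ : X → Matrix (Fin N) (Fin N) ℂ) (a b : Fin N) :
    ∑ y, w y * (liftMatY (Matrix (Fin N) (Fin N) ℂ) M Φ y a b).im ^ 2 = ∑ y, w y * ((M *ᵥ fun x => (Φ x a b).im) y) ^ 2 :=
  Finset.sum_congr rfl fun y _ => by rw [← im_liftMatY_apply]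

/-! ## §2 ★★★ The three local letters at def-Y's letters from the real letters -/

/-- ★★★ **THE LOCAL LETTERS FROM THE REAL LETTERS.**  Given a cube site set `D`, a 0∕1 bond cut `χ`, a real class `𝒯ᵣ` with the real local Lemma-2.4 letter
(constant `κ`), the real (2.11) letter on `ker qpK ∩ {supp ⊆ D}` (constant `π`) and the real supported axial decomposition of every cut real field `χ·v`, THERE ARE
classes `𝒯`, `𝒩` of `M_N(ℂ)`-valued fields satisfying VERBATIM the three hypotheses `hL24`, `h𝒩`, `hdec` of
`…N06Row17LocalCentreCoerciveReduction.coer_trIP_padDeltaALocY_one_of_classes` (with the same `κ`, `π`) — so the centre number `m_□ = min 1 γ(κ, π)` of row 17's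
local road follows from the two real letters (+ (2.11)). [cite: Balaban1984PropagatorsII, (2.7) p.224, (2.11) p.225, (2.121) p.244, Lemma 2.4 (2.128) p.245; Balaban1985BackgroundPropagators, p.395 («if U = 1»), Thm 3.11 proof p.416, pp.408–409] -/
theorem local_letters_of_real_letters (D : Finset (SiteY i)) (χ : FBondY i → ℝ) {κ π : ℝ} (𝒯ᵣ : Set (FBondY i → ℝ))
    (hL24r : ∀ v ∈ 𝒯ᵣ, κ * ∑ b, v b ^ 2 ≤ ∑ p, (curlK i *ᵥ v) p ^ 2 + ∑ ι, i.w ι * (qK i *ᵥ v) ι ^ 2)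
    (hPr : ∀ g : SiteY i → ℝ, qpK i *ᵥ g = 0 → (∀ z, z ∉ D → g z = 0) → π * ∑ z, g z ^ 2 ≤ ∑ b, (gradK i *ᵥ g) b ^ 2)
    (hdecr : ∀ v : FBondY i → ℝ, ∃ g : SiteY i → ℝ, qpK i *ᵥ g = 0 ∧ (∀ z, z ∉ D → g z = 0) ∧
      (fun b => χ b * v b) - gradK i *ᵥ g ∈ 𝒯ᵣ) :
    ∃ (𝒯 : Set (FBondY i → Matrix (Fin N) (Fin N) ℂ)) (𝒩 : Set (SiteY i → Matrix (Fin N) (Fin N) ℂ)),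
      (∀ B ∈ 𝒯, κ * trIP (fun _ => (1 : ℝ)) B B ≤
        trIP (fun _ => (1 : ℝ)) (curlY i (fun _ _ => 1) B) (curlY i (fun _ _ => 1) B)
          + trIP i.w (QY i (parBY i) (fun _ _ => 1) B) (QY i (parBY i) (fun _ _ => 1) B)) ∧
      (∀ Λ ∈ 𝒩, QpY i (parSymY i) (fun _ _ => 1) Λ = 0 ∧ cubeProjY i D Λ = Λ ∧
        π * trIP (fun _ => (1 : ℝ)) Λ Λ ≤ trIP (fun _ => (1 : ℝ)) (gradY i (fun _ _ => 1) Λ) (gradY i (fun _ _ => 1) Λ)) ∧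
      (∀ Ψ : FBondY i → Matrix (Fin N) (Fin N) ℂ, ∃ B ∈ 𝒯, ∃ Λ ∈ 𝒩, cutMulY χ Ψ = B + gradY i (fun _ _ => 1) Λ) := by
  refine ⟨{B | ∀ a b : Fin N, (fun x => (B x a b).re) ∈ 𝒯ᵣ ∧ (fun x => (B x a b).im) ∈ 𝒯ᵣ},
    {Λ | QpY i (parSymY i) (fun _ _ => 1) Λ = 0 ∧ cubeProjY i D Λ = Λ ∧
      π * trIP (fun _ => (1 : ℝ)) Λ Λ ≤ trIP (fun _ => (1 : ℝ)) (gradY i (fun _ _ => 1) Λ) (gradY i (fun _ _ => 1) Λ)},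
    fun B hB => ?_, fun Λ hΛ => hΛ, fun Ψ => ?_⟩
  · -- the Lemma-2.4 letter, slice by slice
    rw [curlY_one, QY_one i (parBY_one i), trIP_self_eq_sum_entries, trIP_self_eq_sum_entries, trIP_self_eq_sum_entries, Finset.mul_sum,
      ← Finset.sum_add_distrib]
    refine Finset.sum_le_sum fun a _ => ?_
    rw [Finset.mul_sum, ← Finset.sum_add_distrib]
    refine Finset.sum_le_sum fun b _ => ?_
    obtain ⟨hre, him⟩ := hB a b
    have h1 := hL24r _ hre
    have h2 := hL24r _ him
    rw [sum_sq_re_liftMatY, sum_sq_im_liftMatY, sum_sq_re_liftMatY, sum_sq_im_liftMatY]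
    simp only [one_mul] at h1 h2 ⊢
    rw [mul_add]
    linarith
  · -- the decomposition: assemble `Λ` and `B` from the `2N²` real slices
    choose gr hgr using fun a b : Fin N => hdecr fun x => (Ψ x a b).re
    choose gi hgi using fun a b : Fin N => hdecr fun x => (Ψ x a b).im
    let Λ : SiteY i → Matrix (Fin N) (Fin N) ℂ := fun z => Matrix.of fun a b => ⟨gr a b z, gi a b z⟩
    have hΛre : ∀ a b, (fun z => (Λ z a b).re) = gr a b := fun _ _ => rfl
    have hΛim : ∀ a b, (fun z => (Λ z a b).im) = gi a b := fun _ _ => rfl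
    have hQp : QpY i (parSymY i) (fun _ _ => 1) Λ = 0 := by
      rw [QpY_one i (parSymY_one i)]
      refine eq_zero_of_entries (fun a b y => ?_) (fun a b y => ?_)
      · have h := congrFun (re_liftMatY_apply (qpK i) Λ a b) y
        rw [h, hΛre, (hgr a b).1, Pi.zero_apply]
      · have h := congrFun (im_liftMatY_apply (qpK i) Λ a b) y
        rw [h, hΛim, (hgi a b).1, Pi.zero_apply]
    have hsupp : cubeProjY i D Λ = Λ := by
      funext z
      rw [cubeProjY_apply]
      split_ifs with hz
      · rfl
      · symm; ext a b
        exact Complex.ext ((hgr a b).2.1 z hz) ((hgi a b).2.1 z hz)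
    have hP : π * trIP (fun _ => (1 : ℝ)) Λ Λ ≤ trIP (fun _ => (1 : ℝ)) (gradY i (fun _ _ => 1) Λ) (gradY i (fun _ _ => 1) Λ) := by
      rw [gradY_one, trIP_self_eq_sum_entries, trIP_self_eq_sum_entries, Finset.mul_sum]
      refine Finset.sum_le_sum fun a _ => ?_
      rw [Finset.mul_sum]
      refine Finset.sum_le_sum fun b _ => ?_
      rw [sum_sq_re_liftMatY, sum_sq_im_liftMatY, hΛre, hΛim]
      have h1 := hPr (gr a b) (hgr a b).1 (hgr a b).2.1
      have h2 := hPr (gi a b) (hgi a b).1 (hgi a b).2.1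
      have e1 : ∑ x, (Λ x a b).re ^ 2 = ∑ x, gr a b x ^ 2 := rfl
      have e2 : ∑ x, (Λ x a b).im ^ 2 = ∑ x, gi a b x ^ 2 := rfl
      simp only [one_mul]
      rw [mul_add, e1, e2]
      linarith
    refine ⟨cutMulY χ Ψ - gradY i (fun _ _ => 1) Λ, fun a b => ?_, Λ, ⟨hQp, hsupp, hP⟩, (sub_add_cancel _ _).symm⟩
    -- the slices of `B = M_χΨ − D₁Λ` are the real decompositions
    have hre : (fun x => ((cutMulY χ Ψ - gradY i (fun _ _ => 1) Λ) x a b).re) = (fun x => χ x * (Ψ x a b).re) - gradK i *ᵥ gr a b := by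
      funext x
      rw [Pi.sub_apply, Matrix.sub_apply, Complex.sub_re, re_cutMulY_apply, gradY_one, Pi.sub_apply,
        congrFun (re_liftMatY_apply (gradK i) Λ a b) x, hΛre]
    have him : (fun x => ((cutMulY χ Ψ - gradY i (fun _ _ => 1) Λ) x a b).im) = (fun x => χ x * (Ψ x a b).im) - gradK i *ᵥ gi a b := by
      funext x
      rw [Pi.sub_apply, Matrix.sub_apply, Complex.sub_im, im_cutMulY_apply, gradY_one, Pi.sub_apply,
        congrFun (im_liftMatY_apply (gradK i) Λ a b) x, hΛim]
    rw [hre, him]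
    exact ⟨(hgr a b).2.2, (hgi a b).2.2⟩

end Summit.QuantumFields.YangMills.BalabanUVNodes.N06Row17LocalCentreLetters

end
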